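import Summits.BirchSwinnertonDyer.BirchSwinnertonDyer.Theorems.CMKolyvaginAtInertTwoPairMemberCanonicalKolAtTwo
import HarnessLib

/-!
# Route `CMKolyvaginAtInertTwo`, crux `CMKolyvaginExactAtInertTwo` (stmt-BirchSwinnertonDyer-24277):
# the member formulas of `E` (Lemma 5.3 local term, Prop. 4.7, canonical composition), DEPTH PARITIES GENERIC

Seat `bsd-line-cmk2-p1` g17 (cell `bsd-print-cf2`); helper (`--supports stmt-BirchSwinnertonDyer-24277`).
THEOREMS ONLY: no definition, no named fact, no `sorry`; no item is closed; BSD is not proved by this.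
WHY. The landed `hloc₁_canonical_of_rel_of_kol` / `hV₁_of_localTerm_of_kol` / `hV₁_canonical_of_kol` hard-wire
"classes of `E` at EVEN depth": the branch `ε(E/ℚ) = -1`, where Kolyvagin's class of `y_K` is `τ`-invariant and
descends to `H¹(ℚ, E[2^M])` (`E` holds `x`, slot `V₁` of `PairDataM`). The crux's hypotheses allow `ε(E/ℚ) = +1`
too (`y_K` non-torsion only forces `ε(E/K) = -1`): then `y_K`'s class is `τ`-anti-invariant, the twin holds `x`
and `E` carries the ODD depths (slot `V₂`). The proofs use the parities only through the displayed Lemma 4.3 /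
Prop. 4.4 hypotheses and `|ℓm'| = |m'| + 1`, so they are re-run VERBATIM with free predicates `Par₁` (depths of
the classes of `E`), `Par₂` (of the twin) and the link `hPar`. `(Even, Odd)` = the landed theorems; `(Odd, Even)`
= the input of slot `V₂ := H¹(ℚ, E[2^{2L}])` in `card_mul_card_le_two_pow_two_mul_of_pairData` (p717813).
* `hloc₁_canonical_of_rel_of_par`, `hV₁_of_localTerm_of_par`, `hV₁_canonical_of_par`.
References: [McCallumLMS1991] §4 Prop. 4.4, 4.7, §5 Lemma 5.3, Thm. 5.4; [MilneADT2006] I Thm. 4.10, §6 Prop. 6.9;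
[GrossDurham1991] §3 and [Kolyvagin1989Izv] §3 (the sign `τ y_n = -ε (-1)^{|n|} y_n` deciding the branch).
-/

set_option linter.dupNamespace false -- tree convention: `Summit.BirchSwinnertonDyer.BirchSwinnertonDyer.Theorems` (summit = sub-problem)
set_option autoImplicit false

noncomputable section

open scoped Classical AddSubgroup

namespace Summit.BirchSwinnertonDyer.BirchSwinnertonDyer.Theorems.KolyvaginPairDataTwo

open WeierstrassCurve NumberField IsDedekindDomain Field Function Rat.HeightOneSpectrum Literature.GroupTheory.FiniteAbelian
open Literature.NumberTheory.EllipticCurves Literature.NumberTheory.GaloisRepresentations Literature.NumberTheory.GaloisCohomology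
open Literature.NumberTheory.GaloisRepresentations.DiscreteGaloisModule (mu)
open Literature.NumberTheory.EllipticCurves.KolyvaginDescent Summit.BirchSwinnertonDyer.BirchSwinnertonDyer.Theorems.GenusExact.ReductionCyclic
open Summit.BirchSwinnertonDyer.BirchSwinnertonDyer.Theorems.GenusExact.VisiblePairAtTwo

section ParHloc

variable {W : WeierstrassCurve ℚ} [W.IsElliptic] [W.IsGloballyMinimal] {K : Type} [Field K] [NumberField K]
  {L : ℕ}

/-- **`hloc₁` (McCallum's Lemma 5.3 for the local term at `λ` of the member `E`), depth parity generic**: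
`hloc₁_canonical_of_rel_of_kol` with the parity `Odd |m'|` of the other member's depth replaced by a free
predicate `Par₂` (asked of Prop. 4.4 across and of the conclusion alike); proof verbatim.
[cite: McCallumLMS1991, §4 Prop. 4.4 and Prop. 4.7, §5 Lemma 5.3, Thm. 5.4 (proof)] [cite: MilneADT2006, Ch. I §6, proof of Prop. 6.9] -/
theorem hloc₁_canonical_of_rel_of_par [(twin W K).IsElliptic] {M₀ : ℕ} (c₁ : ℕ → galH1Torsion W (lvl (L + L)))
    (c₂ : ℕ → galH1Torsion (twin W K) (lvl (L + L))) (hΔ : W.Δ < 0) (hL : M₀ ≤ L) (hL1 : 1 ≤ L)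
    (Kol : ℕ → Prop) (hKol : ∀ ℓ, Kol ℓ → kolPrime W K (L + L) ℓ)
    (Par₂ : ℕ → Prop)
    -- McCallum's Prop. 4.4 ACROSS the members, odd depth `m'` to even depth `ℓm'` (Selmer at `λ` ↔ twin class vanishes at `λ`)
    (h44₂₁ : ∀ ℓ m : ℕ, Kol ℓ → KolSupp Kol (ℓ * m) →
      Par₂ m → ∀ a : ℕ,
        ((2 : ℤ) ^ a) • c₁ (ℓ * m) ∈ loc₁ W (L + L) (pl ℓ) ↔ ((2 : ℤ) ^ a) • c₂ m ∈ a₂ W K (L + L) ℓ)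
    (e : geomTorsion W ((2 ^ L * 2 ^ L : ℕ) : ℤ) → geomTorsion W ((2 ^ L * 2 ^ L : ℕ) : ℤ) → AlgebraicClosure ℚ)
    (hμ : ∀ S T, e S T ^ (2 ^ L * 2 ^ L) = 1)
    (hadd₁ : ∀ S₁ S₂ T, e (S₁ + S₂) T = e S₁ T * e S₂ T)
    (hadd₂ : ∀ S T₁ T₂, e S (T₁ + T₂) = e S T₁ * e S T₂)
    (hgal : ∀ (σ : absoluteGaloisGroup ℚ) (S T : geomTorsion W ((2 ^ L * 2 ^ L : ℕ) : ℤ)),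
      σ • e S T = e (σ • S) (σ • T))
    (halt : ∀ T, e T T = 1) (hnondeg : ∀ T, (∀ S, e S T = 1) → T = 0) :
    ∀ ℓ m' : ℕ, (hℓ : Kol ℓ) → KolSupp Kol (ℓ * m') → ¬ ℓ ∣ m' →
      Par₂ m' →
      ∀ (j N a b : ℕ) (t : galH1Torsion W (lvl (L + L))), t ∈ selmerGroup W (lvl (L + L)) →
      ((2 : ℤ) ^ j) • c₁ (ℓ * m') ∈ selmerGroup W (lvl (L + L)) →
      ((2 : ℤ) ^ N) • t = 0 → ((2 : ℤ) ^ L) • t = 0 →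
      (∀ q ∈ m'.primeFactors, t ∈ a₁ W (L + L) q) → L + L - M₀ ≤ j → N + M₀ ≤ L + L → N ≤ j →
      a + b + 1 = N → ((2 : ℤ) ^ (a + (j - N))) • c₂ m' ∉ a₂ W K (L + L) ℓ →
      ((2 : ℤ) ^ b) • t ∉ a₁ W (L + L) ℓ →
      ∀ D : FirstCaseData W (2 ^ L),
        D.b₁ = torsionH1OfDvd W (lvl_dvd_sq L) (((2 : ℤ) ^ (j - L)) • c₁ (ℓ * m')) →
        galoisCohomology.map (inclKD W (2 ^ L) (2 ^ L)) 1 D.b' = torsionH1OfDvd W (lvl_dvd_sq L) t →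
        D.localTerm e hμ hadd₁ hadd₂ hgal (LocalInvariants.canonical ℚ (2 ^ L * 2 ^ L))
          (Sum.inr (primesEquiv.symm ⟨ℓ, (hKol ℓ hℓ).1⟩)) ≠ 0 := by
  intro ℓ m' hℓ hsupp _hndvd hodd j N a b t _ht _hz _hN _h2 _hAq hj hNM hNj hab hcm hbt D hD₁ hDt
  have hℓp : ℓ.Prime := (hKol ℓ hℓ).1
  haveI : Fact ℓ.Prime := ⟨hℓp⟩
  haveI : NeZero (2 ^ L) := ⟨pow_ne_zero L two_ne_zero⟩
  haveI : NeZero (2 ^ L * 2 ^ L) := ⟨by positivity⟩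
  have hjL : L ≤ j := by omega
  -- ### (Y) `2^{b+L} β'_ℓ ≠ 0`
  have hY : ((2 : ℤ) ^ (b + L)) • D.β' (Sum.inr (primesEquiv.symm ⟨ℓ, hℓp⟩)) ≠ 0 := by
    intro h0
    apply hbt
    letI : Algebra ℚ (Place.Completion (Sum.inr (primesEquiv.symm ⟨ℓ, hℓp⟩) : Place ℚ)) :=
      Place.instAlgebraCompletion _
    -- `[m]_* (2^b β') = 0` by `ι_* ∘ [m]_* = m` and the injectivity of `ι_*` over `ℚ_ℓ`
    have h1 : galoisCohomology.map ((mulK W (2 ^ L) (2 ^ L)).restrictField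
        (Place.Completion (Sum.inr (primesEquiv.symm ⟨ℓ, hℓp⟩) : Place ℚ))) 1
        (((2 : ℤ) ^ b) • D.β' (Sum.inr (primesEquiv.symm ⟨ℓ, hℓp⟩))) = 0 := by
      apply map_inclKD_restrictField_injective_of_kolPrime hΔ (hKol ℓ hℓ)
      rw [map_zero, map_inclKD_map_mulK_restrictField, smul_smul,
        show (((2 ^ L : ℕ) : ℤ)) * (2 : ℤ) ^ b = (2 : ℤ) ^ (b + L) by push_cast; ring, h0]
    -- `res_ℓ (2^b b') = 0` at level `m`
    have h2 : galoisCohomology.res (W.torsionGaloisModule ((2 ^ L : ℕ) : ℤ))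
        (Place.Completion (Sum.inr (primesEquiv.symm ⟨ℓ, hℓp⟩) : Place ℚ)) 1 (((2 : ℤ) ^ b) • D.b') = 0 := by
      rw [map_zsmul, ← D.map_β' (Sum.inr (primesEquiv.symm ⟨ℓ, hℓp⟩)), ← map_zsmul]
      exact h1
    -- `res_ℓ (ι (2^b t)) = 0` at level `m²`
    have h3 : galoisCohomology.res (W.torsionGaloisModule ((2 ^ L * 2 ^ L : ℕ) : ℤ))
        (Place.Completion (Sum.inr (primesEquiv.symm ⟨ℓ, hℓp⟩) : Place ℚ)) 1
        (torsionH1OfDvd W (lvl_dvd_sq L) (((2 : ℤ) ^ b) • t)) = 0 := by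
      have e3 : torsionH1OfDvd W (lvl_dvd_sq L) (((2 : ℤ) ^ b) • t) =
          galoisCohomology.map (inclKD W (2 ^ L) (2 ^ L)) 1 (((2 : ℤ) ^ b) • D.b') := by
        refine (map_zsmul _ _ _).trans (Eq.trans ?_ (map_zsmul _ _ _).symm)
        exact congrArg (fun z => ((2 : ℤ) ^ b) • z) hDt.symm
      rw [e3, galoisCohomology.res_map_one, h2, map_zero]
    have h4 : torsionH1OfDvd W (lvl_dvd_sq L) (((2 : ℤ) ^ b) • t) ∈
        W.torsionLocalKer (Place.Completion (Sum.inr (primesEquiv.symm ⟨ℓ, hℓp⟩) : Place ℚ))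
          ((2 ^ L * 2 ^ L : ℕ) : ℤ) :=
      (@mem_torsionLocalKer_iff_res_eq_zero ℚ _ W
        (Place.Completion (Sum.inr (primesEquiv.symm ⟨ℓ, hℓp⟩) : Place ℚ)) _ (Place.instAlgebraCompletion _) _ _
        (charZero_placeCompletion _) (2 ^ L * 2 ^ L) (NeZero.ne (2 ^ L * 2 ^ L)) _).mpr h3
    have h5 : ((2 : ℤ) ^ b) • t ∈
        W.torsionLocalKer (Place.Completion (Sum.inr (primesEquiv.symm ⟨ℓ, hℓp⟩) : Place ℚ)) (lvl (L + L)) :=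
      (torsionH1OfDvd_mem_torsionLocalKer_iff_of_eq W _ (lvl_dvd_sq L) (lvl_add_eq_sq L) _).mp h4
    exact (mem_a₁_iff hℓp _).mpr h5
  -- ### the exponents: `b + 1 ≤ L`, else (Y) contradicts `2^{2L} β' = 0`
  by_cases hbL : b + 1 ≤ L
  swap
  · exfalso
    apply hY
    have hkill : (2 ^ L * 2 ^ L) • D.β' (Sum.inr (primesEquiv.symm ⟨ℓ, hℓp⟩)) = 0 :=
      nsmul_continuousCohomology_one_eq_zero _ (2 ^ L * 2 ^ L)
        (fun P : geomTorsion W ((2 ^ L * 2 ^ L : ℕ) : ℤ) => AddSubgroup.torsionBy.nsmul P) _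
    have e1 : (2 : ℤ) ^ (b + L) = (2 : ℤ) ^ (b + L - (L + L)) * ((2 ^ L * 2 ^ L : ℕ) : ℤ) := by
      rw [Nat.cast_mul, Nat.cast_pow, Nat.cast_ofNat, ← pow_add, ← pow_add]
      congr 1
      omega
    rw [e1, mul_smul, natCast_zsmul, hkill, smul_zero]
  -- ### (X) `2^{a+L-N} res_ℓ b₁ ∉ 𝓛_ℓ`, and the generic lemma
  refine localTerm_canonical_ne_zero_of_kolPrime hΔ (hKol ℓ hℓ) (by omega) e hμ hadd₁ hadd₂ hgal halt hnondeg D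
    (a := a + L - N) (b := b + L) ?_ hY (by omega)
  intro hmem
  apply hcm
  have epow : ((2 : ℤ) ^ (a + (j - N))) • c₁ (ℓ * m') =
      ((2 : ℤ) ^ (a + L - N)) • (((2 : ℤ) ^ (j - L)) • c₁ (ℓ * m')) := by
    rw [smul_smul, ← pow_add (2 : ℤ) (a + L - N) (j - L), show a + L - N + (j - L) = a + (j - N) by omega]
  have h6 : torsionH1OfDvd W (lvl_dvd_sq L) (((2 : ℤ) ^ (a + (j - N))) • c₁ (ℓ * m')) ∈
      selmerLocalKer W ((primesEquiv.symm ⟨ℓ, hℓp⟩ : HeightOneSpectrum (𝓞 ℚ)).adicCompletion ℚ)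
        ((2 ^ L * 2 ^ L : ℕ) : ℤ) := by
    refine mem_selmerLocalKer_of_mem_kummerLocalConditionAt_res W _ _ ?_
    rw [epow, map_zsmul (torsionH1OfDvd W (lvl_dvd_sq L)) ((2 : ℤ) ^ (a + L - N)), ← hD₁]
    convert hmem using 1
    exact map_zsmul _ _ _
  have h7 : ((2 : ℤ) ^ (a + (j - N))) • c₁ (ℓ * m') ∈
      selmerLocalKer W ((primesEquiv.symm ⟨ℓ, hℓp⟩ : HeightOneSpectrum (𝓞 ℚ)).adicCompletion ℚ) (lvl (L + L)) :=
    (torsionH1OfDvd_mem_selmerLocalKer_iff W _ (lvl_dvd_sq L) _).mpr h6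
  have h8 : ((2 : ℤ) ^ (a + (j - N))) • c₁ (ℓ * m') ∈ loc₁ W (L + L) (pl ℓ) := by
    rw [pl_of_prime hℓp]; exact h7
  exact (h44₂₁ ℓ m' hℓ hsupp hodd (a + (j - N))).mp h8

end ParHloc

section ParMemberOne

variable {W : WeierstrassCurve ℚ} [W.IsElliptic] [W.IsGloballyMinimal] {K : Type} [Field K] [NumberField K]
  {L : ℕ}

/-- **McCallum's Prop. 4.7 for the member `E` of the `ℚ`-pair at `2`, depth parity generic**: the value
formula `hV₁` for the pulled-back level-`2^L` Cassels–Tate pairing of `E` FROM the local term at `λ` (`hloc₁`,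
displayed), = `hV₁_of_localTerm_of_kol` with `Even |m|` (Lemma 4.3 for `c₁`) replaced by `Par₁ m`, `Odd |m'|`
by `Par₂ m'`, and the bookkeeping `|ℓm'| = |m'| + 1` by the displayed link `hPar`; proof verbatim otherwise.
[cite: McCallumLMS1991, §4 Prop. 4.7, §5 Lemma 5.3, Thm. 5.4 (proof)] [cite: MilneADT2006, Ch. I §6, Prop. 6.9] -/
theorem hV₁_of_localTerm_of_par {M₀ : ℕ} (c₁ : ℕ → galH1Torsion W (lvl (L + L)))
    (c₂ : ℕ → galH1Torsion (twin W K) (lvl (L + L))) (hΔ : W.Δ < 0)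
    (hρ2 : W.HasSurjectiveModNGaloisRep 2) (hL : M₀ ≤ L)
    (Kol : ℕ → Prop) (hKol : ∀ ℓ, Kol ℓ → kolPrime W K (L + L) ℓ)
    (Par₁ Par₂ : ℕ → Prop)
    (hPar : ∀ ℓ m' : ℕ, Kol ℓ → KolSupp Kol (ℓ * m') → ¬ ℓ ∣ m' → Par₂ m' → Par₁ (ℓ * m'))
    -- `Ш(E/ℚ)[2^{2L}] ⊆ Ш(E/ℚ)[2^L]` (Kolyvagin's annihilator, or FINITENESS of `Ш(E/ℚ)[2^∞]` with `L` large)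
    (hkill : ∀ a ∈ W.sha, ((2 : ℤ) ^ (2 * L)) • a = 0 → ((2 : ℤ) ^ L) • a = 0)
    -- McCallum's Lemma 4.3 over `ℚ` for the classes of even depth (finite places off the depth, infinite places)
    (loc_c₁_fin : ∀ m, KolSupp Kol m → Par₁ m →
      ∀ v : HeightOneSpectrum (𝓞 ℚ), (m : 𝓞 ℚ) ∉ v.asIdeal → c₁ m ∈ selmerLocalKer W (v.adicCompletion ℚ) (lvl (L + L)))
    (loc_c₁_inf : ∀ m, KolSupp Kol m → Par₁ m →
      ∀ w : InfinitePlace ℚ, c₁ m ∈ selmerLocalKer W w.Completion (lvl (L + L)))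
    -- the Cassels–Tate data for `W` at level `2^L`, auxiliary level `2^L · 2^L`
    (e : geomTorsion W ((2 ^ L * 2 ^ L : ℕ) : ℤ) → geomTorsion W ((2 ^ L * 2 ^ L : ℕ) : ℤ) → AlgebraicClosure ℚ)
    (hμ : ∀ S T, e S T ^ (2 ^ L * 2 ^ L) = 1)
    (hadd₁ : ∀ S₁ S₂ T, e (S₁ + S₂) T = e S₁ T * e S₂ T)
    (hadd₂ : ∀ S T₁ T₂, e S (T₁ + T₂) = e S T₁ * e S T₂)
    (hgal : ∀ (σ : absoluteGaloisGroup ℚ) (S T : geomTorsion W ((2 ^ L * 2 ^ L : ℕ) : ℤ)),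
      σ • e S T = e (σ • S) (σ • T))
    (halt : ∀ T, e T T = 1) (inv : LocalInvariants ℚ (2 ^ L * 2 ^ L)) (hPT' : inv.SumInvLocalizationEqZero)
    (hH3 : ∀ c : galoisCohomology (mu ℚ (2 ^ L * 2 ^ L)) 3,
      (∀ v : Place ℚ, galoisCohomology.localization (mu ℚ (2 ^ L * 2 ^ L)) v 3 c = 0) → c = 0)
    (ι₁ : selmerGroup W (lvl (L + L)) →+ (W.sha)[(2 ^ L : ℕ)])
    (hι₁ : ∀ z, shaTorsionVal W (2 ^ L) (ι₁ z) = torsionH1ToH1 W (lvl (L + L)) z)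
    -- McCallum's Lemma 5.3 for the local term at `λ`, in the tree's cochain currency (displayed)
    (hloc₁ : ∀ ℓ m' : ℕ, (hℓ : Kol ℓ) → KolSupp Kol (ℓ * m') → ¬ ℓ ∣ m' →
      Par₂ m' →
      ∀ (j N a b : ℕ) (t : galH1Torsion W (lvl (L + L))), t ∈ selmerGroup W (lvl (L + L)) →
      ((2 : ℤ) ^ j) • c₁ (ℓ * m') ∈ selmerGroup W (lvl (L + L)) →
      ((2 : ℤ) ^ N) • t = 0 → ((2 : ℤ) ^ L) • t = 0 →
      (∀ q ∈ m'.primeFactors, t ∈ a₁ W (L + L) q) → L + L - M₀ ≤ j → N + M₀ ≤ L + L → N ≤ j →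
      a + b + 1 = N → ((2 : ℤ) ^ (a + (j - N))) • c₂ m' ∉ a₂ W K (L + L) ℓ →
      ((2 : ℤ) ^ b) • t ∉ a₁ W (L + L) ℓ →
      ∀ D : FirstCaseData W (2 ^ L),
        D.b₁ = torsionH1OfDvd W (lvl_dvd_sq L) (((2 : ℤ) ^ (j - L)) • c₁ (ℓ * m')) →
        galoisCohomology.map (inclKD W (2 ^ L) (2 ^ L)) 1 D.b' = torsionH1OfDvd W (lvl_dvd_sq L) t →
        D.localTerm e hμ hadd₁ hadd₂ hgal inv (Sum.inr (primesEquiv.symm ⟨ℓ, (hKol ℓ hℓ).1⟩)) ≠ 0) :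
    ∀ ℓ m' : ℕ, Kol ℓ → KolSupp Kol (ℓ * m') → ¬ ℓ ∣ m' →
      Par₂ m' →
      ∀ (j N a b : ℕ) (t : galH1Torsion W (lvl (L + L))) (ht : t ∈ selmerGroup W (lvl (L + L)))
        (hz : ((2 : ℤ) ^ j) • c₁ (ℓ * m') ∈ selmerGroup W (lvl (L + L))),
      ((2 : ℤ) ^ N) • t = 0 → ((2 : ℤ) ^ L) • t = 0 →
      (∀ q ∈ m'.primeFactors, t ∈ a₁ W (L + L) q) → L + L - M₀ ≤ j →
      N + M₀ ≤ L + L → N ≤ j → a + b + 1 = N →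
      ((2 : ℤ) ^ (a + (j - N))) • c₂ m' ∉ a₂ W K (L + L) ℓ →
      ((2 : ℤ) ^ b) • t ∉ a₁ W (L + L) ℓ →
      ((ctLevelPairing W (2 ^ L) e hμ hadd₁ hadd₂ hgal inv halt hPT' hH3
        (localTerm_finite_support (W := W) (m := 2 ^ L) (e := e) (hμ := hμ) (hadd₁ := hadd₁) (hadd₂ := hadd₂)
          (hgal := hgal) halt inv)).comp ι₁).compl₂ ι₁ ⟨_, hz⟩ ⟨t, ht⟩ ≠ 0 := by
  intro ℓ m' hℓ hsupp hndvd hodd j N a b t ht hz hN h2 hAq hj hNM hNj hab hcm hbt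
  have ht2 : t ∈ selmerGroup W (lvl (L + L)) := ht
  have hz2 : ((2 : ℤ) ^ j) • c₁ (ℓ * m') ∈ selmerGroup W (lvl (L + L)) := hz
  have hN2 : ((2 : ℤ) ^ N) • t = 0 := hN
  have h22 : ((2 : ℤ) ^ L) • t = 0 := h2
  have hAq2 : ∀ q ∈ m'.primeFactors, t ∈ a₁ W (L + L) q := hAq
  have hj2 : L + L - M₀ ≤ j := hj
  have hNM2 : N + M₀ ≤ L + L := hNM
  have hcm2 : ((2 : ℤ) ^ (a + (j - N))) • c₂ m' ∉ a₂ W K (L + L) ℓ := hcm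
  have hbt2 : ((2 : ℤ) ^ b) • t ∉ a₁ W (L + L) ℓ := hbt
  have hℓp : ℓ.Prime := (hKol ℓ hℓ).1
  haveI : NeZero (2 ^ L) := ⟨pow_ne_zero L two_ne_zero⟩
  have hΔ : W.Δ < 0 := hΔ
  have hjL : L ≤ j := by omega
  have heven : Par₁ (ℓ * m') := hPar ℓ m' hℓ hsupp hndvd hodd
  set v₀ : HeightOneSpectrum (𝓞 ℚ) := primesEquiv.symm ⟨ℓ, hℓp⟩ with hv₀
  -- unfold the pulled-back pairing
  change ctLevelPairing W (2 ^ L) e hμ hadd₁ hadd₂ hgal inv halt hPT' hH3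
    (localTerm_finite_support (W := W) (m := 2 ^ L) (e := e) (hμ := hμ) (hadd₁ := hadd₁) (hadd₂ := hadd₂)
      (hgal := hgal) halt inv) (ι₁ ⟨_, hz⟩) (ι₁ ⟨t, ht⟩) ≠ 0
  -- the map `ι'` at level `2^L · 2^L`
  have hsha : ∀ c ∈ W.sha, ((2 : ℤ) ^ (2 * L)) • c = 0 → ((2 : ℤ) ^ L) • c = 0 :=
    hkill
  have hL' : ∀ c ∈ W.sha, (((2 ^ L * 2 ^ L : ℕ) : ℤ)) • c = 0 → ((2 ^ L : ℕ) : ℤ) • c = 0 := by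
    intro c hc h0
    rw [Nat.cast_pow, Nat.cast_ofNat]
    refine hsha c hc ?_
    rwa [Nat.cast_mul, Nat.cast_pow, Nat.cast_ofNat, ← pow_add, ← two_mul] at h0
  obtain ⟨ι', hι'⟩ := exists_selmerToShaTorsion W (2 ^ L) hL'
  -- transport to the level `2^L · 2^L`
  have hzτ : torsionH1OfDvd W (lvl_dvd_sq L) (((2 : ℤ) ^ j) • c₁ (ℓ * m')) ∈
      selmerGroup W ((2 ^ L * 2 ^ L : ℕ) : ℤ) := torsionH1OfDvd_mem_selmerGroup W _ hz2
  have htτ : torsionH1OfDvd W (lvl_dvd_sq L) t ∈ selmerGroup W ((2 ^ L * 2 ^ L : ℕ) : ℤ) :=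
    torsionH1OfDvd_mem_selmerGroup W _ ht2
  have hιz : ι₁ ⟨_, hz⟩ = ι' ⟨torsionH1OfDvd W (lvl_dvd_sq L) (((2 : ℤ) ^ j) • c₁ (ℓ * m')), hzτ⟩ :=
    Subtype.ext (Subtype.ext (by
      change shaTorsionVal W (2 ^ L) (ι₁ ⟨_, hz⟩) = shaTorsionVal W (2 ^ L) (ι' ⟨_, hzτ⟩)
      rw [hι₁, hι', torsionH1ToH1_torsionH1OfDvd]))
  have hιt : ι₁ ⟨t, ht⟩ = ι' ⟨torsionH1OfDvd W (lvl_dvd_sq L) t, htτ⟩ :=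
    Subtype.ext (Subtype.ext (by
      change shaTorsionVal W (2 ^ L) (ι₁ ⟨t, ht⟩) = shaTorsionVal W (2 ^ L) (ι' ⟨_, htτ⟩)
      rw [hι₁, hι', torsionH1ToH1_torsionH1OfDvd]))
  rw [hιz, hιt]
  -- `z' = 2^L • b₁`
  have hz' : ((⟨torsionH1OfDvd W (lvl_dvd_sq L) (((2 : ℤ) ^ j) • c₁ (ℓ * m')), hzτ⟩ :
      selmerGroup W ((2 ^ L * 2 ^ L : ℕ) : ℤ)) : galH1Torsion W ((2 ^ L * 2 ^ L : ℕ) : ℤ)) =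
      ((2 ^ L : ℕ) : ℤ) • torsionH1OfDvd W (lvl_dvd_sq L) (((2 : ℤ) ^ (j - L)) • c₁ (ℓ * m')) := by
    change torsionH1OfDvd W (lvl_dvd_sq L) (((2 : ℤ) ^ j) • c₁ (ℓ * m')) = _
    rw [← map_zsmul, zsmul_pow_sub_eq hjL]
  -- first-case data: `[2^L]_* t' = 0` (`2^L t = 0` displayed, `E(ℚ) ∩ E[2^L] = 0`)
  have h2W := DokchitserDokchitser2012.forall_two_nsmul_of_hasSurjectiveModNGaloisRep_two W two_ne_zero hρ2
  have hfix : ∀ P : geomTorsion W ((2 ^ L : ℕ) : ℤ), (∀ σ : absoluteGaloisGroup ℚ, σ • P = P) → P = 0 :=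
    geomTorsion_fixed_eq_zero_of_forall_two_nsmul W h2W L
  have h2L : ((2 ^ L : ℕ) : ℤ) • t = 0 := by
    rw [Nat.cast_pow, Nat.cast_ofNat]
    exact h22
  have hmt : ((2 ^ L : ℕ) : ℤ) • torsionH1OfDvd W (lvl_dvd_sq L) t = 0 := by
    rw [← map_zsmul, h2L, map_zero]
  have hb₁ : ((2 ^ L : ℕ) : ℤ) • torsionH1OfDvd W (lvl_dvd_sq L) (((2 : ℤ) ^ (j - L)) • c₁ (ℓ * m')) ∈
      selmerGroup W ((2 ^ L * 2 ^ L : ℕ) : ℤ) := by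
    rw [← map_zsmul, zsmul_pow_sub_eq hjL]; exact hzτ
  obtain ⟨D, hD₁, hDt⟩ := exists_firstCaseData_of_zsmul_of_map_mulK_eq_zero W (2 ^ L) hb₁ htτ
    (map_mulK_eq_zero_of_zsmul_eq_zero W (2 ^ L) hfix hmt)
  rw [ctLevelPairing_pullback_ne_zero_iff_localTerm e hμ hadd₁ hadd₂ hgal inv halt hPT' hH3 _ ι' hι'
    ⟨_, hzτ⟩ ⟨_, htτ⟩ hz' D hD₁ hDt (Sum.inr v₀) ?_]
  · exact hloc₁ ℓ m' hℓ hsupp hndvd hodd j N a b t ht2 hz2 hN2 h22 hAq2 hj2 hNM2 hNj hab hcm2 hbt2 D hD₁ hDt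
  -- ### the places `v ≠ v_ℓ`
  intro v hv
  rcases v with w | v'
  · -- an infinite place: Lemma 4.3 at `∞`
    left
    have hc : c₁ (ℓ * m') ∈ selmerLocalKer W (Place.Completion (Sum.inl w : Place ℚ)) (lvl (L + L)) :=
      loc_c₁_inf (ℓ * m') hsupp heven w
    have hc' := (torsionH1OfDvd_mem_selmerLocalKer_iff W (Place.Completion (Sum.inl w : Place ℚ))
      (lvl_dvd_sq L) _).mp hc
    have key := mem_kummerLocalConditionAt_res_of_mem_selmerLocalKer W _ _ hc'
    rw [map_zsmul]
    convert AddSubgroup.zsmul_mem _ key ((2 : ℤ) ^ (j - L)) using 1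
    exact map_zsmul _ _ _
  · by_cases hdiv : ((ℓ * m' : ℕ) : 𝓞 ℚ) ∈ v'.asIdeal
    · -- a place of `ℓ m'` other than `v_ℓ`: a place `v_q`, `q ∣ m'`
      right
      have hm' : ((m' : ℕ) : 𝓞 ℚ) ∈ v'.asIdeal := by
        rcases natCast_mem_or_natCast_mem_of_mul_mem hdiv with h1 | h1
        · exact absurd ((natCast_prime_mem_iff_eq hℓp v').mp h1) (fun h ↦ hv (by rw [h]))
        · exact h1
      -- a prime factor `q` of `m'` with `q ∈ v'`
      obtain ⟨hsqm', hkolm'⟩ : KolSupp Kol m' := by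
        have hmem : ℓ ∈ (ℓ * m').primeFactors :=
          Nat.mem_primeFactors.mpr ⟨hℓp, dvd_mul_right ℓ m', hsupp.1.ne_zero⟩
        obtain ⟨h, -⟩ := kolSupp_div hsupp hmem
        rwa [Nat.mul_div_cancel_left m' hℓp.pos] at h
      haveI := v'.isPrime
      have hprod : ((∏ q ∈ m'.primeFactors, q : ℕ) : 𝓞 ℚ) ∈ v'.asIdeal := by
        rwa [Nat.prod_primeFactors_of_squarefree hsqm']
      rw [Nat.cast_prod] at hprod
      obtain ⟨q, hq, hqv⟩ := Ideal.IsPrime.prod_mem_iff.mp hprod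
      have hqp : q.Prime := Nat.prime_of_mem_primeFactors hq
      have hkq : kolPrime W K (L + L) q := hKol q (hkolm' q hq)
      have hv'eq : v' = primesEquiv.symm ⟨q, hqp⟩ := (natCast_prime_mem_iff_eq hqp v').mp hqv
      subst hv'eq
      refine ⟨?_, map_inclKD_restrictField_injective_of_kolPrime hΔ hkq⟩
      -- `loc_q t' = 0`
      have htq : t ∈ W.torsionLocalKer ((primesEquiv.symm ⟨q, hqp⟩ : HeightOneSpectrum (𝓞 ℚ)).adicCompletion ℚ)
          (lvl (L + L)) := (mem_a₁_iff hqp t).mp (hAq2 q hq)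
      have htq' := torsionH1OfDvd_mem_torsionLocalKer W
        (Place.Completion (Sum.inr (primesEquiv.symm ⟨q, hqp⟩) : Place ℚ)) (lvl_dvd_sq L) htq
      -- (`CharZero ℚ_q` passed explicitly: as an instance it would let `DivisionRing.toRatAlgebra` compete with
      -- `Place.instAlgebraCompletion`)
      exact (@mem_torsionLocalKer_iff_res_eq_zero ℚ _ W
        (Place.Completion (Sum.inr (primesEquiv.symm ⟨q, hqp⟩) : Place ℚ)) _ (Place.instAlgebraCompletion _) _ _
        (charZero_placeCompletion _) (2 ^ L * 2 ^ L) (NeZero.ne (2 ^ L * 2 ^ L)) _).mp htq'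
    · -- a finite place not dividing `ℓ m'`: Lemma 4.3 over `ℚ`
      left
      have hc : c₁ (ℓ * m') ∈ selmerLocalKer W (Place.Completion (Sum.inr v' : Place ℚ)) (lvl (L + L)) :=
        loc_c₁_fin (ℓ * m') hsupp heven v' hdiv
      have hc' := (torsionH1OfDvd_mem_selmerLocalKer_iff W (Place.Completion (Sum.inr v' : Place ℚ))
        (lvl_dvd_sq L) _).mp hc
      have key := mem_kummerLocalConditionAt_res_of_mem_selmerLocalKer W _ _ hc'
      rw [map_zsmul]
      convert AddSubgroup.zsmul_mem _ key ((2 : ℤ) ^ (j - L)) using 1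
      exact map_zsmul _ _ _

end ParMemberOne

section ParCanonical

variable {W : WeierstrassCurve ℚ} [W.IsElliptic] [W.IsGloballyMinimal] {K : Type} [Field K] [NumberField K]
  {L : ℕ} [(twin W K).IsElliptic] [NeZero (2 ^ L * 2 ^ L)]

/-- **The member formula `hV₁` for THE Cassels–Tate pairing of `E` at level `2^L`, depth parity generic**:
`hV₁_of_localTerm_of_par` ∘ `hloc₁_canonical_of_rel_of_par` with Tate's reciprocity and `Ш³(ℚ, μ) = 0`
supplied (= `hV₁_canonical_of_kol` for `(Par₁, Par₂) = (Even, Odd)`; the branch `ε(E/ℚ) = +1` takes `(Odd, Even)`).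
[cite: McCallumLMS1991, §4 Prop. 4.7, §5 Lemma 5.3, Thm. 5.4 (proof)] [cite: MilneADT2006, Ch. I Thm. 4.10 and §6 Prop. 6.9] -/
theorem hV₁_canonical_of_par {M₀ : ℕ} (c₁ : ℕ → galH1Torsion W (lvl (L + L)))
    (c₂ : ℕ → galH1Torsion (twin W K) (lvl (L + L))) (hΔ : W.Δ < 0)
    (hρ2 : W.HasSurjectiveModNGaloisRep 2) (hL : M₀ ≤ L) (hL1 : 1 ≤ L)
    (Kol : ℕ → Prop) (hKol : ∀ ℓ, Kol ℓ → kolPrime W K (L + L) ℓ)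
    (Par₁ Par₂ : ℕ → Prop)
    (hPar : ∀ ℓ m' : ℕ, Kol ℓ → KolSupp Kol (ℓ * m') → ¬ ℓ ∣ m' → Par₂ m' → Par₁ (ℓ * m'))
    (hkill : ∀ a ∈ W.sha, ((2 : ℤ) ^ (2 * L)) • a = 0 → ((2 : ℤ) ^ L) • a = 0)
    (loc_c₁_fin : ∀ m, KolSupp Kol m → Par₁ m →
      ∀ v : HeightOneSpectrum (𝓞 ℚ), (m : 𝓞 ℚ) ∉ v.asIdeal → c₁ m ∈ selmerLocalKer W (v.adicCompletion ℚ) (lvl (L + L)))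
    (loc_c₁_inf : ∀ m, KolSupp Kol m → Par₁ m →
      ∀ w : InfinitePlace ℚ, c₁ m ∈ selmerLocalKer W w.Completion (lvl (L + L)))
    (h44₂₁ : ∀ ℓ m : ℕ, Kol ℓ → KolSupp Kol (ℓ * m) →
      Par₂ m → ∀ a : ℕ,
        ((2 : ℤ) ^ a) • c₁ (ℓ * m) ∈ loc₁ W (L + L) (pl ℓ) ↔ ((2 : ℤ) ^ a) • c₂ m ∈ a₂ W K (L + L) ℓ)
    (e : geomTorsion W ((2 ^ L * 2 ^ L : ℕ) : ℤ) → geomTorsion W ((2 ^ L * 2 ^ L : ℕ) : ℤ) → AlgebraicClosure ℚ)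
    (hμ : ∀ S T, e S T ^ (2 ^ L * 2 ^ L) = 1)
    (hadd₁ : ∀ S₁ S₂ T, e (S₁ + S₂) T = e S₁ T * e S₂ T)
    (hadd₂ : ∀ S T₁ T₂, e S (T₁ + T₂) = e S T₁ * e S T₂)
    (hgal : ∀ (σ : absoluteGaloisGroup ℚ) (S T : geomTorsion W ((2 ^ L * 2 ^ L : ℕ) : ℤ)),
      σ • e S T = e (σ • S) (σ • T))
    (halt : ∀ T, e T T = 1) (hnondeg : ∀ T, (∀ S, e S T = 1) → T = 0)
    (ι₁ : selmerGroup W (lvl (L + L)) →+ (W.sha)[(2 ^ L : ℕ)])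
    (hι₁ : ∀ z, shaTorsionVal W (2 ^ L) (ι₁ z) = torsionH1ToH1 W (lvl (L + L)) z) :
    ∀ ℓ m' : ℕ, Kol ℓ → KolSupp Kol (ℓ * m') → ¬ ℓ ∣ m' →
      Par₂ m' →
      ∀ (j N a b : ℕ) (t : galH1Torsion W (lvl (L + L))) (ht : t ∈ selmerGroup W (lvl (L + L)))
        (hz : ((2 : ℤ) ^ j) • c₁ (ℓ * m') ∈ selmerGroup W (lvl (L + L))),
      ((2 : ℤ) ^ N) • t = 0 → ((2 : ℤ) ^ L) • t = 0 →
      (∀ q ∈ m'.primeFactors, t ∈ a₁ W (L + L) q) → L + L - M₀ ≤ j →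
      N + M₀ ≤ L + L → N ≤ j → a + b + 1 = N →
      ((2 : ℤ) ^ (a + (j - N))) • c₂ m' ∉ a₂ W K (L + L) ℓ →
      ((2 : ℤ) ^ b) • t ∉ a₁ W (L + L) ℓ →
      ((ctLevelPairing W (2 ^ L) e hμ hadd₁ hadd₂ hgal (LocalInvariants.canonical ℚ (2 ^ L * 2 ^ L)) halt
        (sumInvLocalizationEqZero_canonical_of_numberField ℚ (2 ^ L * 2 ^ L)) (shaThree_mu_eq_zero ℚ (2 ^ L * 2 ^ L))
        (localTerm_finite_support (W := W) (m := 2 ^ L) (e := e) (hμ := hμ) (hadd₁ := hadd₁) (hadd₂ := hadd₂)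
          (hgal := hgal) halt (LocalInvariants.canonical ℚ (2 ^ L * 2 ^ L)))).comp ι₁).compl₂ ι₁ ⟨_, hz⟩ ⟨t, ht⟩ ≠ 0 := by
  exact hV₁_of_localTerm_of_par c₁ c₂ hΔ hρ2 hL Kol hKol Par₁ Par₂ hPar hkill loc_c₁_fin loc_c₁_inf e hμ hadd₁ hadd₂
    hgal halt
    (LocalInvariants.canonical ℚ (2 ^ L * 2 ^ L))
    (sumInvLocalizationEqZero_canonical_of_numberField ℚ (2 ^ L * 2 ^ L))
    (shaThree_mu_eq_zero ℚ (2 ^ L * 2 ^ L)) ι₁ hι₁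
    (hloc₁_canonical_of_rel_of_par c₁ c₂ hΔ hL hL1 Kol hKol Par₂ h44₂₁ e hμ hadd₁ hadd₂ hgal halt hnondeg)

end ParCanonical

end Summit.BirchSwinnertonDyer.BirchSwinnertonDyer.Theorems.KolyvaginPairDataTwo

end
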